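import Literature.AnabelianGeometry.SemiGraphs.BTempQDPairHomHatGen
import Literature.AnabelianGeometry.SemiGraphs.BTempQDPairCategoryP
import HarnessLib

/-!
# Semi-graphs of anabelioids, Appendix, proof of Theorem A.4: `Hom^ ⥲ Hom_T` for ARBITRARY
# QD-pairs of `B^temp(Π)` (proofs)

Mochizuki, *Semi-graphs of anabelioids*, Publ. RIMS **42** (2006) 221–322, Appendix, proof of
Theorem A.4, manuscript pp. 84–85 (PRIMS p. 314 l. 9 – p. 315 l. 2)
[cite: MochizukiSemiAnbd2006, Thm A.4 proof pp.84-85]: "the natural projections of this direct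
product determine bijections as follows: `Hom^((B, Γ_B), (C, Γ_C)) ⥲ Hom^((B′, Γ_B′), (C′, Γ_C′))
⥲ Hom_{T_i}(q_i((B′, Γ_B′)), q_i((C′, Γ_C′))) ⥲ Hom_{T_i}(q_i((B, Γ_B)), q_i((C, Γ_C)))` … the
definition of `Hom^`, as well as the resulting bijection of `Hom^` with `Hom_{T_i}` and the natural
map from `Hom` to `Hom^`, extend immediately to pairs of objects of `D_i` that are not necessarily
weakly connected."

Proof-only companion (no definitions) of `BTempQDPairHomHatGen.lean` (row **A4-lim-gen** of
`plan/L3/SUBDAG-SemiAnbd-Cor311.md`, seat abc-iut-w4-d089), for the model temperoid `B^temp(Π)`: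

* **`HomHatGen.toHom_injective`** (any `Π`, any pairs): the arrows `q(B′_b → B)` are jointly
  surjective on points and `Hom^((B′_b, Γ), (C, Γ_C)) → Hom_T` is injective (abc-iut-w4-d081,
  `homHatToHom_injective`);
* **`HomHatGen.toHom_surjective`** (`Π` tempered, any pairs): restrict a given arrow
  `u : B/Γ_B → C/Γ_C` to each component, `q(B′_b → B) ≫ u`, realise it in `Hom^((B′_b, Γ), (C, Γ_C))`
  (abc-iut-w5-d129, `homHatToHom_surjective`, source strongly connected, target arbitrary), and check
  the matching through the injection (`orbitQuotientMap_componentIso_inv_incl`: `q(γ_B) = 1` on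
  `B/Γ_B`); hence **`HomHatGen.toHom_bijective`** — "the resulting bijection of `Hom^` with `Hom_{T_i}`
  … [for] pairs … not necessarily weakly connected";
* the WEAKLY CONNECTED case as printed: **`HomHatGen.proj_bijective`** — each projection
  `Hom^((B, Γ_B), (C, Γ_C)) → Hom^((B′_b, Γ_{B′_b}), (C, Γ_C))` is a bijection when `Γ_B` acts
  transitively on `π₀(B)` (abc-iut-w4-d048, `isIso_orbitQuotientMap_componentIncl`:
  `q((B′, Γ_B′)) ⥲ q((B, Γ_B))`), and `toHom_eq_of_isWeaklyConnected` — the printed composite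
  `⥲ Hom_T(q(B′), q(C)) ⥲ Hom_T(q(B), q(C))`.

Elementary; nothing refers to the IUT corpus; no side is taken on any disputed claim.
-/

open CategoryTheory

namespace Literature.AnabelianGeometry.SemiGraphs

open Literature.AlgebraicGeometry.Frobenioids.QuasiTemperoid.BTempConnected (hom_ext_apply)

universe u

variable {G : Type u} [Group G] [TopologicalSpace G] [IsTopologicalGroup G]

namespace QDPair

namespace HomHatGen

variable {P C : QDPair (BTemp G)}

/-! ### Injectivity: the components `q(B′_b → B)` are jointly surjective -/

/-- **`Hom^((B, Γ_B), (C, Γ_C)) → Hom_T(B/Γ_B, C/Γ_C)` is injective** for arbitrary pairs (any `Π`): a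
family is recovered from its glued arrow by restriction to the components and the injection
`Hom^((B′_b, Γ), (C, Γ_C)) ↪ Hom_T`. [cite: MochizukiSemiAnbd2006, Thm A.4 proof pp.84-85] -/
theorem toHom_injective : Function.Injective (toHom : HomHatGen P C → _) := by
  intro y y' h
  ext b
  apply homHatToHom_injective
  rw [← orbitQuotientMap_incl_toHom, ← orbitQuotientMap_incl_toHom, h]

/-! ### Surjectivity: realise the restrictions to the components -/

/-- Moving the component by `γ_B ∈ Γ_B` does not change its image in `B/Γ_B`:
`q((B′_b ⥲ B′_{b′})⁻¹) ≫ q(B′_b → B) = q(B′_{b′} → B)` (because `q(γ_B) = 1`).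
[cite: MochizukiSemiAnbd2006, Thm A.4 proof p.84] -/
theorem orbitQuotientMap_componentIso_inv_incl {b b' : P.A.obj.V} (γ : Aut P.A) (hγ : γ ∈ P.Γ)
    (h : ∃ a : G, P.A.obj.ρ a b' = (γ.hom.hom.hom b : P.A.obj.V)) :
    orbitQuotientMap (componentIso γ h hγ).inv ≫ orbitQuotientMap (P.componentIncl b) =
      orbitQuotientMap (P.componentIncl b') := by
  have hq : orbitQuotientMap (componentIso γ h hγ).hom ≫ orbitQuotientMap (P.componentIncl b') =
      orbitQuotientMap (P.componentIncl b) := by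
    rw [componentIso_hom]
    exact orbitQuotientMap_componentHom_comp γ h hγ
  haveI := isIso_orbitQuotientMap_iso (componentIso γ h hγ)
  rw [← hq, ← Category.assoc, ← inv_orbitQuotientMap_iso, IsIso.inv_hom_id, Category.id_comp]

/-- **`Hom^((B, Γ_B), (C, Γ_C)) → Hom_T(B/Γ_B, C/Γ_C)` is surjective** for arbitrary pairs, `Π`
tempered: every arrow of `T` restricts on each component `B′_b` to an arrow
`B′_b/Γ → C/Γ_C`, which "arises from some morphism of strongly connected QD-pairs" (realisation,
source strongly connected, target arbitrary); these realisations match.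
[cite: MochizukiSemiAnbd2006, Thm A.4 proof pp.84-85] -/
theorem toHom_surjective (hG : IsTempered G) : Function.Surjective (toHom : HomHatGen P C → _) := by
  intro u
  have hex : ∀ b : P.A.obj.V, ∃ x : HomHat (P.componentPair b) C,
      homHatToHom _ C x = orbitQuotientMap (P.componentIncl b) ≫ u := fun b =>
    homHatToHom_surjective hG C (P.componentPair_isStronglyConnected b) _
  choose x hx using hex
  refine ⟨⟨x, fun b b' γ hγ h => ?_⟩, ?_⟩
  · apply homHatToHom_injective
    rw [homHatToHom_map_id, hx, hx, ← Category.assoc, orbitQuotientMap_componentIso_inv_incl]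
  · apply P.orbitQuotient_hom_ext
    apply hom_ext_apply
    intro z
    change ((toHom ⟨x, _⟩).hom.hom (P.orbitMk z) : C.orbitQuotient.obj.V) = u.hom.hom (P.orbitMk z)
    rw [toHom_apply]
    change ((homHatToHom _ C (x z)).hom.hom
      ((P.componentPair z).orbitMk (BTemp.orbitPt P.A z)) : C.orbitQuotient.obj.V) = _
    rw [hx]
    rfl

/-- **"The resulting bijection of `Hom^` with `Hom_{T_i}`" for arbitrary pairs** of `B^temp(Π)`, `Π`
tempered. [cite: MochizukiSemiAnbd2006, Thm A.4 proof pp.84-85] -/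
theorem toHom_bijective (hG : IsTempered G) : Function.Bijective (toHom : HomHatGen P C → _) :=
  ⟨toHom_injective, toHom_surjective hG⟩

/-- Matching families in bijection with `Hom_T`: existence and uniqueness form.
[cite: MochizukiSemiAnbd2006, Thm A.4 proof pp.84-85] -/
theorem existsUnique_toHom_eq (hG : IsTempered G) (u : P.orbitQuotient ⟶ C.orbitQuotient) :
    ∃! y : HomHatGen P C, toHom y = u :=
  (Function.bijective_iff_existsUnique _).mp (toHom_bijective hG) u

/-! ### The weakly connected case: the projections are bijections -/

/-- For `(B, Γ_B)` weakly connected the glued arrow is the printed composite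
`(q(B′_b → B))⁻¹ ≫ homHatToHom (y_b)` ("`⥲ Hom_{T_i}(q_i((B′, Γ_B′)), q_i((C′, Γ_C′))) ⥲
Hom_{T_i}(q_i((B, Γ_B)), q_i((C, Γ_C)))`"). [cite: MochizukiSemiAnbd2006, Thm A.4 proof p.84] -/
theorem toHom_eq_of_isWeaklyConnected (hP : P.IsWeaklyConnected) (y : HomHatGen P C)
    (b : P.A.obj.V) :
    haveI := P.isIso_orbitQuotientMap_componentIncl b hP
    toHom y = inv (orbitQuotientMap (P.componentIncl b)) ≫ homHatToHom _ C (y.proj b) := by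
  haveI := P.isIso_orbitQuotientMap_componentIncl b hP
  rw [IsIso.eq_inv_comp, orbitQuotientMap_incl_toHom]

/-- **The projection `Hom^((B, Γ_B), (C, Γ_C)) → Hom^((B′_b, Γ_{B′_b}), (C, Γ_C))` is injective** for
`(B, Γ_B)` weakly connected (any `Π`): `q(B′_b → B)` is an isomorphism.
[cite: MochizukiSemiAnbd2006, Thm A.4 proof p.84] -/
theorem proj_injective (hP : P.IsWeaklyConnected) (b : P.A.obj.V) :
    Function.Injective (fun y : HomHatGen P C => y.proj b) := by
  intro y y' h
  apply toHom_injective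
  haveI := P.isIso_orbitQuotientMap_componentIncl b hP
  rw [← cancel_epi (orbitQuotientMap (P.componentIncl b)), orbitQuotientMap_incl_toHom,
    orbitQuotientMap_incl_toHom]
  exact congrArg (homHatToHom _ C) h

/-- **The projection is surjective** for `(B, Γ_B)` weakly connected, `Π` tempered: glue
`(q(B′_b → B))⁻¹ ≫ homHatToHom (x)` and read off its `b`-component.
[cite: MochizukiSemiAnbd2006, Thm A.4 proof p.84] -/
theorem proj_surjective (hG : IsTempered G) (hP : P.IsWeaklyConnected) (b : P.A.obj.V) :
    Function.Surjective (fun y : HomHatGen P C => y.proj b) := by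
  intro x₀
  haveI := P.isIso_orbitQuotientMap_componentIncl b hP
  obtain ⟨y, hy⟩ :=
    toHom_surjective hG (inv (orbitQuotientMap (P.componentIncl b)) ≫ homHatToHom _ C x₀)
  refine ⟨y, homHatToHom_injective _ _ ?_⟩
  change homHatToHom _ C (y.proj b) = homHatToHom _ C x₀
  rw [← orbitQuotientMap_incl_toHom, hy, IsIso.hom_inv_id_assoc]

/-- **"The natural projections of this direct product determine bijections
`Hom^((B, Γ_B), (C, Γ_C)) ⥲ Hom^((B′, Γ_B′), (C, Γ_C))`"** for `(B, Γ_B)` weakly connected, `Π`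
tempered. [cite: MochizukiSemiAnbd2006, Thm A.4 proof p.84] -/
theorem proj_bijective (hG : IsTempered G) (hP : P.IsWeaklyConnected) (b : P.A.obj.V) :
    Function.Bijective (fun y : HomHatGen P C => y.proj b) :=
  ⟨proj_injective hP b, proj_surjective hG hP b⟩

/-! ### The natural map `Hom → Hom^` and `q` -/

/-- **`toHom (ofHom f) = q(f)`**: the natural map `Hom → Hom^` followed by the comparison is `q`.
[cite: MochizukiSemiAnbd2006, Thm A.4 proof pp.84-85] -/
theorem toHom_ofHom (f : P ⟶ C) : toHom (ofHom f) = orbitQuotientMap f := by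
  apply P.orbitQuotient_hom_ext
  apply hom_ext_apply
  intro x
  change (ofHom f).valAt x = ((orbitQuotientMap f).hom.hom (P.orbitMk x) : C.orbitQuotient.obj.V)
  rw [orbitQuotientMap_apply]
  unfold valAt
  rw [proj_ofHom, QDPair.homHatToHom_homHatOfHom, orbitQuotientMap_apply]
  rfl

/-- For `(B, Γ_B)` itself strongly connected (one component), `ofHom` followed by the projection is
the natural map `Hom → Hom^` of the strongly connected theory, up to the 1-proper cover
`B′_b ⥲ B`: both have comparison arrow `q(f)` restricted along `q(B′_b → B)`.
[cite: MochizukiSemiAnbd2006, Thm A.4 proof p.84] -/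
theorem homHatToHom_proj_ofHom (f : P ⟶ C) (b : P.A.obj.V) :
    homHatToHom _ C ((ofHom f).proj b) = orbitQuotientMap (P.componentIncl b) ≫ orbitQuotientMap f := by
  rw [← orbitQuotientMap_incl_toHom, toHom_ofHom]

end HomHatGen

end QDPair

end Literature.AnabelianGeometry.SemiGraphs
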